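import Mathlib
import Summits.KontsevichZagierPeriods.KontsevichZagierPeriods.Theorems.SoloInformedNashImage
import Summits.KontsevichZagierPeriods.KontsevichZagierPeriods.Theorems.SoloInformedFnAlg
import Summits.KontsevichZagierPeriods.KontsevichZagierPeriods.Theorems.SoloInformedCxImplicit
import HarnessLib
import HarnessLib.Audit

/-!
# SoloInformed — the band germ (PRES-RAT(2), Phase III-3a)

Solo programme `solo-KontsevichZagierPeriods-informed`, session s110.  A *band* is a plane
region `{(x, y) | 0 < x < 1, a(x) < y < b(x)}` between two Nash functions; the straightening
`Φ(s, t) = (s, a(s) + t (b(s) − a(s)))` maps the open unit square onto it with Jacobian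
`b(s) − a(s)`.  For the Nash-image lemma (`soloInformed_presentable_of_nashImage`) the pulled
back integrand `F(Φ(s,t)) · (b(s) − a(s))` must be the real part of a CUBE GERM
(`SoloInformedCubeGerm 2`): complex-analytic on a neighbourhood of the CLOSED square, real on real
points, algebraic over `ℚ(z₁, z₂)`.  This file packages the complex data of a band
(`SoloInformedBandData`: boundary germs `A`, `B` analytic on a complex neighbourhood `V` of the
segment `[0,1]` and real on reals, an integrand germ `F` analytic on an open `W ⊆ ℂ²` and real on
reals, and the algebraicity of the composite — discharged for rational `F` by the closure lemmas of
`SoloInformedFnAlg`) and builds the germ `SoloInformedBandData.germ`, with the evaluation of its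
real part at real points (`SoloInformedBandData.germ_re`).  Degenerate ends `a = b` at `s = 0, 1`
are allowed (the Jacobian may vanish on the boundary of the square).

References: Kontsevich–Zagier 2001 §1.2; Bochnak–Coste–Roy 1998 §2.9, §8.1 (Nash functions);
folklore (straightening a band).
-/

noncomputable section

open scoped BigOperators Topology
open Set Filter Metric

namespace Summit.KontsevichZagierPeriods.KontsevichZagierPeriods.Theorems

/-! ### The band substitution `w = A(z₁) + z₂ (B(z₁) − A(z₁))` -/

/-- The second coordinate of the complexified band straightening. [this work] -/
def soloInformedBandY (A B : ℂ → ℂ) (z : Fin 2 → ℂ) : ℂ :=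
  A (z 0) + z 1 * (B (z 0) - A (z 0))

/-- The complexified band straightening `z ↦ (z₁, A(z₁) + z₂ (B(z₁) − A(z₁)))`. [this work] -/
def soloInformedBandPt (A B : ℂ → ℂ) (z : Fin 2 → ℂ) : Fin 2 → ℂ :=
  ![z 0, soloInformedBandY A B z]

/-- The domain of the band germ: `z₁ ∈ V` and the straightened point lies in `W`. [this work] -/
def soloInformedBandSet (A B : ℂ → ℂ) (V : Set ℂ) (W : Set (Fin 2 → ℂ)) : Set (Fin 2 → ℂ) :=
  {z | z 0 ∈ V} ∩ soloInformedBandPt A B ⁻¹' W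

/-- The band germ `z ↦ F(z₁, A(z₁) + z₂ (B(z₁) − A(z₁))) · (B(z₁) − A(z₁))`. [this work] -/
def soloInformedBandFn (A B : ℂ → ℂ) (F : (Fin 2 → ℂ) → ℂ) (z : Fin 2 → ℂ) : ℂ :=
  F (soloInformedBandPt A B z) * (B (z 0) - A (z 0))

/-- The first coordinate is analytic. -/
theorem soloInformed_analyticAt_apply_zero (z : Fin 2 → ℂ) :
    AnalyticAt ℂ (fun z : Fin 2 → ℂ => z 0) z :=
  (ContinuousLinearMap.proj (R := ℂ) (φ := fun _ : Fin 2 => ℂ) 0).analyticAt z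

/-- The second coordinate is analytic. -/
theorem soloInformed_analyticAt_apply_one (z : Fin 2 → ℂ) :
    AnalyticAt ℂ (fun z : Fin 2 → ℂ => z 1) z :=
  (ContinuousLinearMap.proj (R := ℂ) (φ := fun _ : Fin 2 => ℂ) 1).analyticAt z

/-- `soloInformedBandY` is analytic where `A` and `B` are. -/
theorem soloInformed_analyticAt_bandY {A B : ℂ → ℂ} {z : Fin 2 → ℂ}
    (hA : AnalyticAt ℂ A (z 0)) (hB : AnalyticAt ℂ B (z 0)) :
    AnalyticAt ℂ (soloInformedBandY A B) z := by
  have h0 := soloInformed_analyticAt_apply_zero z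
  have hA' : AnalyticAt ℂ (fun z : Fin 2 → ℂ => A (z 0)) z :=
    AnalyticAt.fun_comp (f := fun z : Fin 2 → ℂ => z 0) (x := z) hA h0
  have hB' : AnalyticAt ℂ (fun z : Fin 2 → ℂ => B (z 0)) z :=
    AnalyticAt.fun_comp (f := fun z : Fin 2 → ℂ => z 0) (x := z) hB h0
  unfold soloInformedBandY
  exact hA'.add ((soloInformed_analyticAt_apply_one z).mul (hB'.sub hA'))

/-- `soloInformedBandPt` is analytic where `A` and `B` are. -/
theorem soloInformed_analyticAt_bandPt {A B : ℂ → ℂ} {z : Fin 2 → ℂ}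
    (hA : AnalyticAt ℂ A (z 0)) (hB : AnalyticAt ℂ B (z 0)) :
    AnalyticAt ℂ (soloInformedBandPt A B) z := by
  have hY := soloInformed_analyticAt_bandY hA hB
  have h0 := soloInformed_analyticAt_apply_zero z
  unfold soloInformedBandPt
  refine AnalyticAt.pi (𝕜 := ℂ) (Fm := fun _ : Fin 2 => ℂ)
    (f := fun i z => (![z 0, soloInformedBandY A B z] : Fin 2 → ℂ) i) fun i => ?_
  fin_cases i
  · simpa using h0
  · simpa using hY

/-- `soloInformedBandPt` is continuous on `{z | z₁ ∈ V}` when `A`, `B` are continuous on `V`. -/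
theorem soloInformed_continuousOn_bandPt {A B : ℂ → ℂ} {V : Set ℂ}
    (hA : ContinuousOn A V) (hB : ContinuousOn B V) :
    ContinuousOn (soloInformedBandPt A B) {z : Fin 2 → ℂ | z 0 ∈ V} := by
  have h0 : ContinuousOn (fun z : Fin 2 → ℂ => z 0) {z : Fin 2 → ℂ | z 0 ∈ V} :=
    (continuous_apply 0).continuousOn
  have hm : MapsTo (fun z : Fin 2 → ℂ => z 0) {z : Fin 2 → ℂ | z 0 ∈ V} V := fun z hz => hz
  have hA' : ContinuousOn (fun z : Fin 2 → ℂ => A (z 0)) _ := hA.comp h0 hm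
  have hB' : ContinuousOn (fun z : Fin 2 → ℂ => B (z 0)) _ := hB.comp h0 hm
  have hY : ContinuousOn (soloInformedBandY A B) {z : Fin 2 → ℂ | z 0 ∈ V} := by
    unfold soloInformedBandY
    exact hA'.add (((continuous_apply 1).continuousOn).mul (hB'.sub hA'))
  refine continuousOn_pi.2 fun i => ?_
  fin_cases i
  · simpa [soloInformedBandPt] using h0
  · simpa [soloInformedBandPt] using hY

/-- The domain of the band germ is open. -/
theorem soloInformed_isOpen_bandSet {A B : ℂ → ℂ} {V : Set ℂ} {W : Set (Fin 2 → ℂ)}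
    (hV : IsOpen V) (hW : IsOpen W) (hA : ContinuousOn A V) (hB : ContinuousOn B V) :
    IsOpen (soloInformedBandSet A B V W) :=
  (soloInformed_continuousOn_bandPt hA hB).isOpen_inter_preimage (hV.preimage (continuous_apply 0)) hW

/-! ### Real points -/

/-- At a real point the substitution is real, with the expected real part. -/
theorem soloInformed_bandY_toC (A B : ℂ → ℂ) (y : Fin 2 → ℝ)
    (hA : (A (y 0)).im = 0) (hB : (B (y 0)).im = 0) :
    soloInformedBandY A B (soloInformedToC 2 y) =
      (((A (y 0)).re + y 1 * ((B (y 0)).re - (A (y 0)).re) : ℝ) : ℂ) := by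
  apply Complex.ext
  · simp [soloInformedBandY, soloInformedToC_apply, Complex.mul_re, hA, hB]
  · simp [soloInformedBandY, soloInformedToC_apply, Complex.mul_im, hA, hB]

/-- At a real point the straightened point is the complexification of a real point. -/
theorem soloInformed_bandPt_toC (A B : ℂ → ℂ) (y : Fin 2 → ℝ)
    (hA : (A (y 0)).im = 0) (hB : (B (y 0)).im = 0) :
    soloInformedBandPt A B (soloInformedToC 2 y) =
      soloInformedToC 2 ![y 0, (A (y 0)).re + y 1 * ((B (y 0)).re - (A (y 0)).re)] := by
  funext i
  fin_cases i
  · simp [soloInformedBandPt, soloInformedToC_apply]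
  · simp [soloInformedBandPt, soloInformedToC_apply, soloInformed_bandY_toC A B y hA hB]

/-! ### Band data and the band germ -/

/-- **Band data.**  The complex-analytic data of a band `a(x) < y < b(x)` over `0 < x < 1` with an
integrand germ `F`: `A`, `B` are analytic on an open `V ⊆ ℂ` containing the closed segment
`[0, 1]` and real on its real points (`a = Re A`, `b = Re B` on `[0, 1]`); `F` is analytic on an
open `W ⊆ ℂ²` and real on real points; the straightened closed square lies in `W`; and the
composite `F(z₁, A + z₂ (B − A)) · (B − A)` is algebraic over `ℚ(z₁, z₂)` on the germ domain (for
rational `F = N/D` and algebraic `A`, `B` this is `SoloInformedAlgOn.eval₂` + `.div`). [this work] -/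
structure SoloInformedBandData where
  /-- the lower boundary germ (`a = Re A` on `[0,1]`) -/
  A : ℂ → ℂ
  /-- the upper boundary germ (`b = Re B` on `[0,1]`) -/
  B : ℂ → ℂ
  /-- a complex neighbourhood of the segment `[0,1]` -/
  V : Set ℂ
  /-- the integrand germ -/
  F : (Fin 2 → ℂ) → ℂ
  /-- the domain of the integrand germ -/
  W : Set (Fin 2 → ℂ)
  /-- `V` is open -/
  isOpen_V : IsOpen V
  /-- `W` is open -/
  isOpen_W : IsOpen W
  /-- `V` contains `[0,1]` -/
  mem_V : ∀ x : ℝ, x ∈ Icc (0 : ℝ) 1 → (x : ℂ) ∈ V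
  /-- `A` is analytic on `V` -/
  analyticA : AnalyticOnNhd ℂ A V
  /-- `B` is analytic on `V` -/
  analyticB : AnalyticOnNhd ℂ B V
  /-- `A` is real on the real points of `V` -/
  realA : ∀ x : ℝ, (x : ℂ) ∈ V → (A x).im = 0
  /-- `B` is real on the real points of `V` -/
  realB : ∀ x : ℝ, (x : ℂ) ∈ V → (B x).im = 0
  /-- `F` is analytic on `W` -/
  analyticF : AnalyticOnNhd ℂ F W
  /-- `F` is real on the real points of `W` -/
  realF : ∀ y : Fin 2 → ℝ, soloInformedToC 2 y ∈ W → (F (soloInformedToC 2 y)).im = 0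
  /-- the straightened closed square lies in `W` -/
  mem_W : ∀ y ∈ soloInformedCube 2, soloInformedBandPt A B (soloInformedToC 2 y) ∈ W
  /-- algebraicity of the composite over `ℚ(z₁, z₂)` on the germ domain -/
  alg : SoloInformedAlgOn (soloInformedBandSet A B V W) (soloInformedBandFn A B F)

namespace SoloInformedBandData

/-- **The band germ** of band data: a cube germ in two variables. [this work] -/
def germ (d : SoloInformedBandData) : SoloInformedCubeGerm 2 where
  U := soloInformedBandSet d.A d.B d.V d.W
  g := soloInformedBandFn d.A d.B d.F
  isOpen := soloInformed_isOpen_bandSet d.isOpen_V d.isOpen_W d.analyticA.continuousOn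
    d.analyticB.continuousOn
  mapsTo := by
    intro y hy
    refine ⟨?_, d.mem_W y hy⟩
    have h0 := (soloInformed_mem_cube_iff.1 hy) 0
    show soloInformedToC 2 y 0 ∈ d.V
    rw [soloInformedToC_apply]
    exact d.mem_V (y 0) ⟨h0.1, h0.2⟩
  analytic := by
    intro z hz
    have hA : AnalyticAt ℂ d.A (z 0) := d.analyticA _ hz.1
    have hB : AnalyticAt ℂ d.B (z 0) := d.analyticB _ hz.1
    have hpt : AnalyticAt ℂ (soloInformedBandPt d.A d.B) z := soloInformed_analyticAt_bandPt hA hB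
    have hF : AnalyticAt ℂ d.F (soloInformedBandPt d.A d.B z) := d.analyticF _ hz.2
    have h0 := soloInformed_analyticAt_apply_zero z
    have hA' : AnalyticAt ℂ (fun z : Fin 2 → ℂ => d.A (z 0)) z :=
      AnalyticAt.fun_comp (f := fun z : Fin 2 → ℂ => z 0) (x := z) hA h0
    have hB' : AnalyticAt ℂ (fun z : Fin 2 → ℂ => d.B (z 0)) z :=
      AnalyticAt.fun_comp (f := fun z : Fin 2 → ℂ => z 0) (x := z) hB h0
    have hF' : AnalyticAt ℂ (fun z : Fin 2 → ℂ => d.F (soloInformedBandPt d.A d.B z)) z :=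
      hF.fun_comp hpt
    unfold soloInformedBandFn
    exact hF'.mul (hB'.sub hA')
  real := by
    intro y hy
    have hV : ((y 0 : ℝ) : ℂ) ∈ d.V := by
      have h := hy.1
      simpa only [mem_setOf_eq, soloInformedToC_apply] using h
    have hA := d.realA _ hV
    have hB := d.realB _ hV
    have hpt := soloInformed_bandPt_toC d.A d.B y hA hB
    have hW : soloInformedToC 2 ![y 0, (d.A (y 0)).re + y 1 * ((d.B (y 0)).re - (d.A (y 0)).re)]
        ∈ d.W := by
      rw [← hpt]; exact hy.2
    have hF := d.realF _ hW
    show (d.F (soloInformedBandPt d.A d.B (soloInformedToC 2 y)) *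
      (d.B (soloInformedToC 2 y 0) - d.A (soloInformedToC 2 y 0))).im = 0
    rw [hpt, soloInformedToC_apply]
    simp [Complex.mul_im, hF, hA, hB]
  algebraic := d.alg

/-- The domain of the band germ. -/
@[simp] theorem germ_U (d : SoloInformedBandData) :
    d.germ.U = soloInformedBandSet d.A d.B d.V d.W := rfl

/-- The function of the band germ. -/
@[simp] theorem germ_g (d : SoloInformedBandData) :
    d.germ.g = soloInformedBandFn d.A d.B d.F := rfl

/-- **Real part of the band germ at a real point**: `Re F(x, a + t (b − a)) · (b − a)` with
`a = Re A(x)`, `b = Re B(x)`. -/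
theorem germ_re (d : SoloInformedBandData) (y : Fin 2 → ℝ) (hV : ((y 0 : ℝ) : ℂ) ∈ d.V)
    (hW : soloInformedBandPt d.A d.B (soloInformedToC 2 y) ∈ d.W) :
    (d.germ.g (soloInformedToC 2 y)).re =
      (d.F (soloInformedToC 2
          ![y 0, (d.A (y 0)).re + y 1 * ((d.B (y 0)).re - (d.A (y 0)).re)])).re *
        ((d.B (y 0)).re - (d.A (y 0)).re) := by
  have hA := d.realA _ hV
  have hB := d.realB _ hV
  have hpt := soloInformed_bandPt_toC d.A d.B y hA hB
  have hW' : soloInformedToC 2 ![y 0, (d.A (y 0)).re + y 1 * ((d.B (y 0)).re - (d.A (y 0)).re)]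
      ∈ d.W := by
    rw [← hpt]; exact hW
  have hF := d.realF _ hW'
  show (d.F (soloInformedBandPt d.A d.B (soloInformedToC 2 y)) *
    (d.B (soloInformedToC 2 y 0) - d.A (soloInformedToC 2 y 0))).re = _
  rw [hpt, soloInformedToC_apply]
  simp [Complex.mul_re, hF, hA, hB]

/-- The real points of the closed square lie in the germ domain. -/
theorem toC_mem_germ_U (d : SoloInformedBandData) {y : Fin 2 → ℝ} (hy : y ∈ soloInformedCube 2) :
    soloInformedToC 2 y ∈ d.germ.U :=
  d.germ.mapsTo hy

end SoloInformedBandData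

end Summit.KontsevichZagierPeriods.KontsevichZagierPeriods.Theorems
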